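/-
Origin: expansion seat `planner-pub-hodgecm-mc-axioms-1-g14-0`, handover #W78 2026-08-20T15:53:55Z md5 e514c4ccf472 (PKG fbfc826d1428 → e514c4ccf472; 137 l.; MECHANICAL (iib-R) rewrite v3.1 of the PKG file as it stands (15 token edits; rules R1x1+RX[h₂']x14)) (`HOME/mc/pub-hodgecm-mc-axioms-1-g14/revendor/kit-r55/stage55/HodgeCM/Model/HStabDischarge.lean`, md5 e514c4ccf472, 137 lines);
landed by the gen-22 packager (p-g22) in gate run 55 REPLACES the earlier landed copy of `HodgeCM/Model/HStabDischarge.lean` (seat copy carried the packager Origin header of an earlier run (stripped)).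
-/
/-
(Θ-sat)/(W1) COURTESY RE-CUT DRAFT by `planner-pub-hodgecm-mc-theta-3-g9-0` 2026-08-19 over the installed bytes 208764575d74 (mc-glue-1 custody;
RUN-37 `Level`-pair / (Θ-sat) pin packet, item (E7) = (C-KfSat)): the pinned theta spaces are now the SATURATED spaces
`thetaSpaceSatOf … (satLevelRegimeOf V hV Γ.K) …`, so the one-level-pair engine takes the finite-level clause
`hK : k · KΓ(Γ') · k⁻¹ ⊆ KΓ(Γ)` (theta-3 `Model/ThetaSpaceSatTranslate.exists_mem_thetaSpaceSatOf_apply_eq_leftTranslate`) and `hStabOf`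
picks `Γ' := Γ₁ ⊓ Γ₂` — `Γ₁` from the level bookkeeping `hLev` (binder TEXT unchanged), `Γ₂ := Γ.infConj k_f` from theta-3's J-satK
`Model/Junction/LevelSaturationConj.exists_level_le_forall_conj_mem_satLevelRegimeOf` — using the (W1) meet of levels and period-1's
`levelImage_mono` (hence + `import HodgeCM.Model.ThetaSatDischarge`; no cycle: that file imports `E2Instance`, not R12).  Statement of
`hStabOf` byte-identical; `exists_mem_Θ_apply_eq_leftTranslate` gains the hypothesis `hK`.
-/
/-
Origin: expansion seat `planner-pub-hodgecm-mc-glue-1-g4-0`, handover M9 = glue-1 #318 HStabDischarge″ md5 efde51c56cc0 (RUN-34 v1 #311 67d8db2337b7 uses (S V c).ιinf Γ / hιΓ ll. 64–97 ⇒ must be re-cut) (`HOME/mc/pub-hodgecm-mc-glue-1-g4/lean/v2/HodgeCM/Model/HStabDischarge.lean`, md5 efde51c5, 111 lines);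
landed by the gen-11 packager (p-g11) in gate run 35 REPLACES the earlier landed copy of `HodgeCM/Model/HStabDischarge.lean` (verbatim).
-/
/-
Origin: CONSTRUCTION seat `planner-pub-hodgecm-mc-glue-1-g4-0` (unit pub-hodgecm-mc-glue-1-g4, gen 4 of mc-glue-1,
node E ASSEMBLER — E-junction of the period lane's (H⁵)), 2026-08-19.  NEW additive leaf
`HodgeCM/Model/HStabDischarge.lean`.  Imports: `ThetaSpaceInputPin` (mc-theta-3-g3: the pin, `thetaSpaceInputIn`,
`levelImage`, `ThetaAdelicSide`) and `ThetaSpaceTranslate` (mc-period-1-g3: `exists_mem_thetaSpaceOf_apply_eq_leftTranslate`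
over the vendored twin of the tree leaf (H⁵) `Literature/NumberTheory/Automorphic/ThetaFormsRationalTranslate.lean`).
No proof holes, no `def`, nothing cited: kernel lemmas.  Expected `#print axioms`: {propext, Classical.choice, Quot.sound}.
v2 RE-CUT 2026-08-19 (glue-1-g4) for the JOINT CUT with mc-theta-3 `Model/ThetaSpaceInputPin` v2 5a6bf8038289 (`S.ιinf` level-free ⇒ binder/hypothesis `hι` dropped, `(S V c).ιinf Γ` ↦ `(S V c).ιinf`; kernel `ThetaAdelicSide.hRat` ⇒ binder/hypothesis `hRat` dropped from `HStabDischarge`/R12 on). Installs ONLY together with the v2 pin and its other re-cut dependents; otherwise the v1 file of the same name stands.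
-/
import Summits.HodgeConjecture.HodgeCM.Model.ThetaSpaceInputPin_2
import Summits.HodgeConjecture.HodgeCM.Model.ThetaSpaceSatTranslate
import Summits.HodgeConjecture.HodgeCM.Model.ThetaSatDischarge
import Summits.HodgeConjecture.HodgeCM.Model.Junction.LevelSaturationConj

/-!
**v2 RE-CUT 2026-08-19 (glue-1-g4) for the JOINT CUT with mc-theta-3 `Model/ThetaSpaceInputPin` v2 5a6bf8038289 (`S.ιinf` level-free ⇒ binder/hypothesis `hι` dropped, `(S V c).ιinf Γ` ↦ `(S V c).ιinf`; kernel `ThetaAdelicSide.hRat` ⇒ binder/hypothesis `hRat` dropped from `HStabDischarge`/R12 on). Installs ONLY together with the v2 pin and its other re-cut dependents; otherwise the v1 file of the same name stands.**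

# E's binder `hStab` (revision 11): discharge modulo rationality DATA and level bookkeeping

Revision 11 of the E2 instance (`Model/E2InstanceR11.lean`) carries, in place of the ball-facts binder `transl`,
the property

* `hStab : ∀ V c (hV : IsAnisotropic L V.Hm), ∀ γ ∈ BallRational.ratImage …, ∀ i Γ, ∃ Γ',
    ∀ F ∈ (thetaSpaceInputIn … (S V c) hV).Θ i Γ, ∃ F' ∈ (thetaSpaceInputIn … (S V c) hV).Θ i Γ', ∀ g, F'.1 g = F.1 (γ * g)`

of the adelic DATA `S` (left-translation stability of the classical theta spaces under `L`-rational `γ`, level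
allowed to shrink).  mc-period-1-g3's `Model/ThetaSpaceTranslate.lean` (over the tree leaf (H⁵)) proves the
form-level statement `ThetaSpace.exists_mem_thetaSpaceOf_apply_eq_leftTranslate`: for `γ` RATIONAL with respect
to `(ιinf, P.ΓU)` — `ιinf γ · k ∈ P.ΓU` with `k` commuting with `ιinf (U(2,1))` — and a level `Δ'` with
`γ Δ' γ⁻¹ ⊆ Δ`, left translates of `thetaSpaceOf P ιinf Δ …` lie in `thetaSpaceOf P ιinf Δ' …`.  Hence `hStab` is
a term over THREE inputs, none of them about theta functions any more:

* `hι`   — level-independence of `(S V c).ιinf` (already a binder of revision 10);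
* `hRat` — rationality DATA: `∀ V c Γ, ∀ γ ∈ ratImage …, ∃ k : G, (S V c).ιinf γ * k ∈ Γ_{G} ∧ ∀ x, Commute k
  ((S V c).ιinf x)` with `G, Γ_G` the regime model's adelic group and its rational points
  (`(V.latticeModel _).G`, `.Γ`; `(S V c).P i).ΓU = .Γ` by `S.hΓU`) — "`ιinf` is the archimedean-factor inclusion
  of `G ≃ G_U(𝔸)`: an `L`-rational `γ` differs from a rational adelic point by its finite-adelic component `k`";
* `hLev` — level bookkeeping: `∀ V (hV) Γ, ∀ γ ∈ ratImage …, ∃ Γ', ∀ δ' ∈ levelImage Γ' hV, γ * δ' * γ⁻¹ ∈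
  levelImage Γ hV` (the level family `Level V` contains a level conjugated into `Γ` by `γ`).

Main statement: `Model.hStabOf hHD hI h₁ h₂ h₃ S hLev : <hStab verbatim>`.
-/

set_option autoImplicit false

noncomputable section

open MulAction NumberField
open Literature.Geometry.ComplexHyperbolic.BallModel (U21 x₀)
open Literature.NumberTheory.Automorphic
open Literature.AlgebraicGeometry.HodgeTheory
open Literature.AlgebraicGeometry.ShimuraVarieties
open Literature.NumberTheory.Automorphic.PicardCM
open HodgeCM.Model.ThetaSpace

namespace HodgeCM
namespace Model

section HStab

variable (hHD : exists_isReal_hodgeModel) (hI : hodgePQ_independent_of_hodgeModel)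
  (h₁ : BallQuotientUniformised)  (h₃ : CMAbelianVarietyRealised)
variable (S : ∀ {L : CMField} {ι₁ : L →+* ℂ} (V : HermSpace3 L ι₁) (c : SeesawCtx L), ThetaAdelicSide V c)

/-- **One level pair.** Left translation by `γ`, rational w.r.t. `(ιinf Γ, Γ_G)` with finite part `k`, carries the
(saturated) classical theta space of type `i` at level `Γ` into the one at any level `Γ'` conjugated into `Γ` by `γ`
whose saturation index is conjugated into that of `Γ` by `k` ((Θ-sat): `hK`). -/
theorem exists_mem_Θ_apply_eq_leftTranslate {L : CMField} {ι₁ : L →+* ℂ} (V : HermSpace3 L ι₁) (c : SeesawCtx L)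
    (hV : IsAnisotropic L V.Hm) (i : Fin 4) (Γ Γ' : Level V)
    {γ : U21} {k : (V.latticeModel printFact_unitaryCompact_holds).G}
    (hγk : (S V c).ιinf γ * k ∈ (V.latticeModel printFact_unitaryCompact_holds).Γ)
    (hk : ∀ x : U21, Commute k ((S V c).ιinf x))
    (hΔ' : ∀ δ' ∈ levelImage hHD hI h₁ h₃ Γ' hV, γ * δ' * γ⁻¹ ∈ levelImage hHD hI h₁ h₃ Γ hV)
    (hK : ∀ a ∈ satLevelRegimeOf V hV Γ'.K, MulAut.conj k a ∈ satLevelRegimeOf V hV Γ.K)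
    {F : weightForms (levelImage hHD hI h₁ h₃ Γ hV) (stabilizer U21 x₀).subtype
      (BallForms.isPullbackCocycle_cotangentCocycle.weightOf x₀)}
    (hF : F ∈ (thetaSpaceInputIn hHD hI h₁ h₃ (S V c) hV).Θ i Γ) :
    ∃ F' ∈ (thetaSpaceInputIn hHD hI h₁ h₃ (S V c) hV).Θ i Γ', ∀ g : U21, F'.1 g = F.1 (γ * g) := by
  have hF₀ : F ∈ thetaSpaceSatOf ((S V c).P i) ((S V c).ιinf) (levelImage hHD hI h₁ h₃ Γ hV)
      (stabilizer U21 x₀).subtype (BallForms.isPullbackCocycle_cotangentCocycle.weightOf x₀)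
      (satLevelRegimeOf V hV Γ.K) ((S V c).P i).weightFunctions := hF
  have hγk' : (S V c).ιinf γ * k ∈ ((S V c).P i).ΓU := by
    rw [(S V c).hΓU i]; exact hγk
  obtain ⟨F', hF', hh⟩ := exists_mem_thetaSpaceSatOf_apply_eq_leftTranslate (P := (S V c).P i)
    (Δ' := levelImage hHD hI h₁ h₃ Γ' hV) (KΓ' := satLevelRegimeOf V hV Γ'.K) hγk' hk hΔ' hK
    ((S V c).P i).weightFunctions hF₀
  refine ⟨F', ?_, fun g => hh g⟩
  show F' ∈ thetaSpaceSatOf ((S V c).P i) ((S V c).ιinf) (levelImage hHD hI h₁ h₃ Γ' hV)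
      (stabilizer U21 x₀).subtype (BallForms.isPullbackCocycle_cotangentCocycle.weightOf x₀)
      (satLevelRegimeOf V hV Γ'.K) ((S V c).P i).weightFunctions
  exact hF'

/-- **E's binder `hStab` (revision 11), verbatim, as a term** over the level-independence `hι` of the
archimedean inclusion, the rationality DATA `hRat` and the level bookkeeping `hLev`.  E-side:
`hStab := Model.hStabOf hHD hI h₁ h₂ h₃ S hLev`. -/
theorem hStabOf
    (hLev : ∀ {L : CMField} {ι₁ : L →+* ℂ} (V : HermSpace3 L ι₁) (hV : IsAnisotropic L V.Hm) (Γ : Level V),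
      ∀ γ ∈ BallRational.ratImage L ι₁ V.Hm V.sylvesterFrame (sylvesterFrame_J V),
      ∃ Γ' : Level V, ∀ δ' ∈ levelImage hHD hI h₁ h₃ Γ' hV, γ * δ' * γ⁻¹ ∈ levelImage hHD hI h₁ h₃ Γ hV)
    {L : CMField} {ι₁ : L →+* ℂ} (V : HermSpace3 L ι₁) (c : SeesawCtx L) (hV : IsAnisotropic L V.Hm) :
    ∀ γ ∈ BallRational.ratImage L ι₁ V.Hm V.sylvesterFrame (sylvesterFrame_J V), ∀ (i : Fin 4) (Γ : Level V),
      ∃ Γ' : Level V, ∀ F ∈ (thetaSpaceInputIn hHD hI h₁ h₃ (S V c) hV).Θ i Γ,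
        ∃ F' ∈ (thetaSpaceInputIn hHD hI h₁ h₃ (S V c) hV).Θ i Γ', ∀ g : U21, F'.1 g = F.1 (γ * g) := by
  intro γ hγ i Γ
  obtain ⟨Γ₁, hΔ₁⟩ := hLev V hV Γ γ hγ
  obtain ⟨k, hγk, hk⟩ := (S V c).hRat γ hγ
  -- J-satK: a level `Γ₂ ≤ Γ` whose saturation index `k` conjugates into that of `Γ`; then `Γ' := Γ₁ ⊓ Γ₂`
  obtain ⟨Γ₂, -, hK₂⟩ := exists_level_le_forall_conj_mem_satLevelRegimeOf V hV k Γ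
  refine ⟨Γ₁ ⊓ Γ₂, fun F hF =>
    exists_mem_Θ_apply_eq_leftTranslate hHD hI h₁ h₃ S V c hV i Γ (Γ₁ ⊓ Γ₂) hγk hk
      (fun δ' hδ' => hΔ₁ δ' (levelImage_mono hHD hI h₁ h₃ (Level.Γ_mono inf_le_left) hV hδ'))
      (fun a ha => hK₂ a (satLevelRegimeOf_mono V hV (Level.le_def.mp inf_le_right) ha)) hF⟩

end HStab

end Model
end HodgeCM

end
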